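import Mathlib.Topology.MetricSpace.Sequences
import Literature.Analysis.FluidPDE.AxisymmetricVorticityTransport
import Summits.NavierStokesRegularity.NavierStokesRegularity.Theorems.L3TimeExponentPincerEquivariantLimit
import Summits.NavierStokesRegularity.NavierStokesRegularity.Theorems.L3TimeExponentPincerRecedingAxis
import HarnessLib.Audit
import HarnessLib

/-!
# L3TimeExponentPincer — axisymmetry about converging axes passes to distributional limits

Support kernel for the crux `L3CascadeJaw` (item stmt-NavierStokesRegularity-19499) of route
`L3TimeExponentPincer`; companion of the receding-axis lemma
(`…Theorems.L3TimeExponentPincerRecedingAxis`) covering the OTHER case of the compactness step (J)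
of planner nsreg-p2's ROUND-12 §2b (`CritSmoothingNoSwirlB ⇐ (SFL³)`): when the symmetry axes of the
zoomed fields stay at bounded distance, along a subsequence they converge, and then the weak limit
is axisymmetric about the limit axis — so (SFL³) applies to it.

* `rotation_about_sub_rotation_about` / `rotation_tendsto_of_tendsto_axis` — the rotations by a
  fixed angle `θ` about the vertical axes through `b_k → b` converge uniformly on `ℝ³`:
  `‖(b_k + R_θ(z - b_k)) - (b + R_θ(z - b))‖ ≤ 2‖b_k - b‖`.
* `contDiff_rotZ_about`, `rotZ_about_neg_rotZ_about` — smoothness and the two-sided inverse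
  (rotation by `-θ` about the same axis); `rotZ_about_eq_of_horizontal_eq` — the rotation depends
  only on the horizontal part of the axis point.
* **`ae_isAxisymmetricAbout_of_tendsto`** — `v_k` locally integrable with locally uniform `L¹`
  bounds, axisymmetric about the vertical axes through `a_k` (`v_k (a_k + R_θ (x - a_k)) = R_θ (v_k x)`),
  `a_k → a`, `v_k → v` against every `g ∈ C_c^∞(ℝ³; ℝ)`, `v` locally integrable ⇒ for every angle
  `θ`, `v (a + R_θ (x - a)) = R_θ (v x)` for a.e. `x` (a.e. axisymmetry about the limit axis);
  scalar twin `ae_isAxisymmetricScalarAbout_of_tendsto`.  Both are instances of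
  `…Theorems.L3TimeExponentPincerEquivariantLimit.ae_comp_eq_of_tendsto_integral_smul`.

WHAT THIS IS NOT: not NS regularity or blow-up; nothing here uses the Navier–Stokes equations;
the crux `L3CascadeJaw` is untouched; no crux claim.
-/

noncomputable section

open MeasureTheory Set Function Filter Topology Metric WithLp
open scoped ENNReal NNReal ContDiff

namespace Summit.NavierStokesRegularity.NavierStokesRegularity.Theorems.L3TimeExponentPincerConvergingAxes

open Literature.Analysis.FluidPDE
open Summit.NavierStokesRegularity.NavierStokesRegularity.Theorems.L3TimeExponentPincerEquivariantLimit
open Summit.NavierStokesRegularity.NavierStokesRegularity.Theorems.L3TimeExponentPincerRecedingAxis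

/-! ### Rotations about converging vertical axes -/

/-- The difference of the rotations by `θ` about the vertical axes through `b` and `b'` is the
constant vector `(b - b') - R_θ (b - b')`. -/
theorem rotation_about_sub_rotation_about (θ : ℝ) (b b' z : EuclideanSpace ℝ (Fin 3)) :
    (b + rotZ θ (z - b)) - (b' + rotZ θ (z - b')) = (b - b') - rotZ θ (b - b') := by
  rw [← rotZL_apply, ← rotZL_apply, ← rotZL_apply, map_sub, map_sub, map_sub]
  abel

/-- `‖(b + R_θ(z - b)) - (b' + R_θ(z - b'))‖ ≤ 2 ‖b - b'‖`, uniformly in `z`. -/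
theorem norm_rotation_about_sub_le (θ : ℝ) (b b' z : EuclideanSpace ℝ (Fin 3)) :
    ‖(b + rotZ θ (z - b)) - (b' + rotZ θ (z - b'))‖ ≤ 2 * ‖b - b'‖ := by
  rw [rotation_about_sub_rotation_about]
  calc ‖(b - b') - rotZ θ (b - b')‖ ≤ ‖b - b'‖ + ‖rotZ θ (b - b')‖ := norm_sub_le _ _
    _ = 2 * ‖b - b'‖ := by rw [norm_rotZ]; ring

/-- **Rotations about converging vertical axes converge**, uniformly on `ℝ³` (stated on bounded
sets, the form consumed by `ae_comp_eq_of_tendsto_integral_smul`): if `b_k → b` then for every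
angle `θ`, `x ↦ b_k + R_θ (x - b_k)` converges to `x ↦ b + R_θ (x - b)`. -/
theorem rotation_tendsto_of_tendsto_axis {b : ℕ → EuclideanSpace ℝ (Fin 3)}
    {bl : EuclideanSpace ℝ (Fin 3)} (hb : Tendsto b atTop (𝓝 bl)) (θ : ℝ) :
    ∀ R ε : ℝ, 0 < ε → ∀ᶠ k in atTop, ∀ z ∈ closedBall (0 : EuclideanSpace ℝ (Fin 3)) R,
      ‖(b k + rotZ θ (z - b k)) - (bl + rotZ θ (z - bl))‖ ≤ ε := by
  intro R ε hε
  have h : ∀ᶠ k in atTop, dist (b k) bl ≤ ε / 2 :=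
    (Metric.tendsto_nhds.1 hb (ε / 2) (by positivity)).mono fun k hk => hk.le
  filter_upwards [h] with k hk z _
  calc ‖(b k + rotZ θ (z - b k)) - (bl + rotZ θ (z - bl))‖ ≤ 2 * ‖b k - bl‖ :=
        norm_rotation_about_sub_le θ _ _ _
    _ ≤ 2 * (ε / 2) := by rw [← dist_eq_norm]; gcongr
    _ = ε := by ring

/-- The rotation about the vertical axis through `a` is smooth (it is affine). -/
theorem contDiff_rotZ_about (a : EuclideanSpace ℝ (Fin 3)) (θ : ℝ) :
    ContDiff ℝ ∞ (fun x : EuclideanSpace ℝ (Fin 3) => a + rotZ θ (x - a)) := by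
  change ContDiff ℝ ∞ (fun x : EuclideanSpace ℝ (Fin 3) => a + rotZL θ (x - a))
  exact contDiff_const.add ((rotZL θ).contDiff.comp (contDiff_id.sub contDiff_const))

/-- The rotation by `-θ` about the same axis is a two-sided inverse. -/
theorem rotZ_about_neg_rotZ_about (a : EuclideanSpace ℝ (Fin 3)) (θ : ℝ) (x : EuclideanSpace ℝ (Fin 3)) :
    a + rotZ (-θ) ((a + rotZ θ (x - a)) - a) = x := by
  rw [add_sub_cancel_left, ← rotZ_add, neg_add_cancel, rotZ_zero, add_sub_cancel]

/-- Same, in the other order. -/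
theorem rotZ_about_rotZ_about_neg (a : EuclideanSpace ℝ (Fin 3)) (θ : ℝ) (x : EuclideanSpace ℝ (Fin 3)) :
    a + rotZ θ ((a + rotZ (-θ) (x - a)) - a) = x := by
  rw [add_sub_cancel_left, ← rotZ_add, add_neg_cancel, rotZ_zero, add_sub_cancel]

/-- The rotation about the vertical axis through `a` depends only on the horizontal part of `a`
(the axis is the same line): users may normalise the vertical components of the axis points. -/
theorem rotZ_about_eq_of_horizontal_eq {a a' : EuclideanSpace ℝ (Fin 3)} (h0 : a 0 = a' 0)
    (h1 : a 1 = a' 1) (θ : ℝ) (x : EuclideanSpace ℝ (Fin 3)) :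
    a + rotZ θ (x - a) = a' + rotZ θ (x - a') := by
  ext i
  fin_cases i <;> simp [h0, h1]

/-! ### Axisymmetry about converging axes passes to the limit -/

/-- **Weak limits of fields axisymmetric about converging axes are axisymmetric about the limit
axis (vector fields).**  Let `v_k : ℝ³ → ℝ³` be locally integrable with locally uniform `L¹`
bounds, axisymmetric about the vertical axes through `a_k` (`v_k (a_k + R_θ (x - a_k)) = R_θ (v_k x)`
for all `θ`, `x`), `a_k → a`, and `v_k → v` against every test function `g ∈ C_c^∞(ℝ³; ℝ)`, with
`v` locally integrable.  Then for every angle `θ`, `v (a + R_θ (x - a)) = R_θ (v x)` for a.e. `x`. -/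
theorem ae_isAxisymmetricAbout_of_tendsto
    {v : ℕ → EuclideanSpace ℝ (Fin 3) → EuclideanSpace ℝ (Fin 3)}
    {vl : EuclideanSpace ℝ (Fin 3) → EuclideanSpace ℝ (Fin 3)} {a : ℕ → EuclideanSpace ℝ (Fin 3)}
    {al : EuclideanSpace ℝ (Fin 3)}
    (hax : ∀ k (θ : ℝ) x, v k (a k + rotZ θ (x - a k)) = rotZ θ (v k x))
    (ha : Tendsto a atTop (𝓝 al))
    (hv : ∀ k, LocallyIntegrable (v k) volume)
    (hbd : ∀ R : ℝ, ∃ C : ℝ, ∀ k,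
      ∫ x in closedBall (0 : EuclideanSpace ℝ (Fin 3)) R, ‖v k x‖ ≤ C)
    (hvl : LocallyIntegrable vl volume)
    (hconv : ∀ g : EuclideanSpace ℝ (Fin 3) → ℝ, ContDiff ℝ ∞ g → HasCompactSupport g →
      Tendsto (fun k => ∫ x, g x • v k x) atTop (𝓝 (∫ x, g x • vl x))) (θ : ℝ) :
    (fun x => vl (al + rotZ θ (x - al))) =ᵐ[volume] fun x => rotZ θ (vl x) := by
  have h := ae_comp_eq_of_tendsto_integral_smul (μ := volume) (f := v) (fl := vl)
    (T := fun k x => a k + rotZ θ (x - a k)) (Tl := fun x => al + rotZ θ (x - al))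
    (Sl := fun x => al + rotZ (-θ) (x - al)) (M := fun _ => rotZL θ) (Ml := rotZL θ)
    (fun k => measurePreserving_rotZ_about _ _) (fun k => isometry_rotZ_about _ _)
    (measurePreserving_rotZ_about _ _) (isometry_rotZ_about _ _) (contDiff_rotZ_about _ _)
    (isometry_rotZ_about _ _) (contDiff_rotZ_about _ _)
    (fun x => rotZ_about_neg_rotZ_about al θ x) (fun x => rotZ_about_rotZ_about_neg al θ x)
    (rotation_tendsto_of_tendsto_axis ha θ) tendsto_const_nhds
    (fun k => Eventually.of_forall fun x => by simp only [rotZL_apply, hax]) hv hbd hvl hconv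
  simpa only [rotZL_apply] using h

/-- **Weak limits of fields invariant under rotations about converging axes are invariant under
the rotations about the limit axis (scalar fields).** -/
theorem ae_isAxisymmetricScalarAbout_of_tendsto
    {q : ℕ → EuclideanSpace ℝ (Fin 3) → ℝ} {ql : EuclideanSpace ℝ (Fin 3) → ℝ}
    {a : ℕ → EuclideanSpace ℝ (Fin 3)} {al : EuclideanSpace ℝ (Fin 3)}
    (hax : ∀ k (θ : ℝ) x, q k (a k + rotZ θ (x - a k)) = q k x)
    (ha : Tendsto a atTop (𝓝 al))
    (hq : ∀ k, LocallyIntegrable (q k) volume)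
    (hbd : ∀ R : ℝ, ∃ C : ℝ, ∀ k,
      ∫ x in closedBall (0 : EuclideanSpace ℝ (Fin 3)) R, ‖q k x‖ ≤ C)
    (hql : LocallyIntegrable ql volume)
    (hconv : ∀ g : EuclideanSpace ℝ (Fin 3) → ℝ, ContDiff ℝ ∞ g → HasCompactSupport g →
      Tendsto (fun k => ∫ x, g x * q k x) atTop (𝓝 (∫ x, g x * ql x))) (θ : ℝ) :
    (fun x => ql (al + rotZ θ (x - al))) =ᵐ[volume] ql := by
  have h := ae_comp_eq_of_tendsto_integral_smul (μ := volume) (f := q) (fl := ql)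
    (T := fun k x => a k + rotZ θ (x - a k)) (Tl := fun x => al + rotZ θ (x - al))
    (Sl := fun x => al + rotZ (-θ) (x - al)) (M := fun _ => (1 : ℝ →L[ℝ] ℝ)) (Ml := (1 : ℝ →L[ℝ] ℝ))
    (fun k => measurePreserving_rotZ_about _ _) (fun k => isometry_rotZ_about _ _)
    (measurePreserving_rotZ_about _ _) (isometry_rotZ_about _ _) (contDiff_rotZ_about _ _)
    (isometry_rotZ_about _ _) (contDiff_rotZ_about _ _)
    (fun x => rotZ_about_neg_rotZ_about al θ x) (fun x => rotZ_about_rotZ_about_neg al θ x)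
    (rotation_tendsto_of_tendsto_axis ha θ) tendsto_const_nhds
    (fun k => Eventually.of_forall fun x => by
      show q k (a k + rotZ θ (x - a k)) = (1 : ℝ →L[ℝ] ℝ) (q k x)
      rw [hax]; rfl) hq hbd hql
    (fun g hg hgs => by simpa only [smul_eq_mul] using hconv g hg hgs)
  filter_upwards [h] with x hx
  rw [hx]
  rfl

end Summit.NavierStokesRegularity.NavierStokesRegularity.Theorems.L3TimeExponentPincerConvergingAxes

end
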